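import Literature.AlgebraicGeometry.ShimuraVarieties.UnitaryShimuraCanonicalModelPrintedForm
import Literature.AlgebraicGeometry.ShimuraVarieties.UnitaryAuxiliaryTorusDatum
import Literature.AlgebraicGeometry.ShimuraVarieties.UnitaryAuxiliaryCanonicalModelPrinted
import Literature.AlgebraicGeometry.ShimuraVarieties.UnitaryCanonicalDescentPredicates
import Literature.AlgebraicGeometry.ShimuraVarieties.UnitaryAuxiliaryReflexTransport
import Literature.AlgebraicGeometry.ShimuraVarieties.UnitaryAuxiliaryTorusReflexNorm
import Literature.AlgebraicGeometry.Motives.FiniteCoproductVarieties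
import Literature.AlgebraicGeometry.Motives.SeparatedQuotient
import Literature.AlgebraicGeometry.Motives.TorsorCoproductQuotient
import Literature.AlgebraicGeometry.Motives.FiniteQuotientFunctor
import Literature.AlgebraicGeometry.Motives.FiniteQuotientBaseChange
import HarnessLib

/-!
# The finite Hecke quotient step of Deligne's canonical models for the compact unitary Shimura surface, PROVED
# ([Deligne1971TravauxShimura] Prop. 5.11 with (5.11.1) and Cor. 5.7): quotient reciprocity descent, the `E♯`-form of
# `Sh_K(G,X)_ℂ` from F1, and the B-side deliverable of the Galois leg `galoisLegDescentOver_of_F1`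

Topic `AlgebraicGeometry/ShimuraVarieties`; namespace `Literature.AlgebraicGeometry.ShimuraVarieties.UnitaryCanonicalModel.HeckeQuotient`.
THEOREMS ONLY (no definition, no named fact, no instance; D-0014).  Cell hodgecm-mathlib, fan B, rung B-I: the compositions
§2–§7 and §9 of the crux workfile `B-plan/Lines/B1HeckeQuotientDescent.lean` v7 (sha16 7a0cf81d9e64e188, planner B-plan2,
landing spec `B1HeckeQuotientDescent.landing.md`, director RULING 2026-08-28T01:38:03Z «land: YES»), with the four registered
stubs replaced by the TREE THEOREMS that closed them — Q `Motives.exists_finiteQuotient_functor` (p592880), B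
`Motives.isSepQuotient_baseChangeHom_of_isProjectiveOver` (p592797), Torsor `Motives.isIso_cofanInj_comp_of_isSepQuotient`
(p591996), R `Aux.exists_finiteIdele_norm_eq_isArtinCorrespondent_of_hasSmallReflex` (p593565) — and every Prop head of the
skeleton STATED AS A THEOREM (the landing spec's lint option): `quotientReciprocityDescent` (§2), `heckeQuotientDescentOver`,
`heckeQuotientDescent` (§3/§5), `auxQuotientDescent` (§6), `isCanonicalDescentAtReflex_of_overReflex`, `galoisLegDescent`,
`galoisLegDescentOver` (§7) and `galoisLegDescentOver_of_F1` (§9, statement VERBATIM v7 :836–:850 — the declaration the fan-A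
seat A-p05 imports).  The reciprocity predicates `formPointsEquiv`, `IsCanonicalDescentOver`, `IsCanonicalDescentUpTo`,
`IsCanonicalDescentOverReflex`, `IsCanonicalDescentAtReflex` are the tree's (`UnitaryCanonicalDescentPredicates.lean`, p593458).
HC_CM is proved only modulo the 7 printed citations until rung 0 closes: the printed citation F1
(`Aux.canonicalModel_exists_printed`, [Deligne1979ShimuraVarieties] 2.3.1) enters ONLY as the hypothesis `hF1` of
`galoisLegDescentOver_of_F1`, and the class-group finiteness g5 as the instance binder `[Finite (Aux.classGroup L L₀)]`.

WHY (the line's thesis).  Chain B reaches the datum `(G, h_U) = (Res_{L⁺/ℚ} U(H), 𝔹²)` from the HODGE-TYPE product datum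
`(G̃, X̃) = (G × T₀, X × {h_Φ})`, whose canonical model over `E♯ = τ(L)·E*(Φ)` is Deligne's theorem for Hodge type (2.3.1 = F1);
since `G̃ = G × T₀` is a PRODUCT datum with `X̃ = X`, the complex Shimura variety of `G̃` at level `K × L₀` is `Δ` disjoint
copies of `Sh_K(G)(ℂ) = Sc.Mc_K` (`Δ = T₀(ℚ)\T₀(𝔸_f)/L₀` finite, acting by Hecke translations simply transitively on the
copies), and (5.11.1) recovers the model of `Sh_K(G)` as the QUOTIENT of the model `N_K` of `Sh_{K×L₀}(G̃)` by `Δ` — a quotient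
of a projective `E♯`-scheme by a finite group of `E♯`-automorphisms, whose base change to `ℂ` is `(∐_Δ Sc.Mc_K)/Δ ≅ Sc.Mc_K`;
the reciprocity law of `N` at the special points descends to (62) for the quotient because the quotient forgets the copy
index.  Under `Aux.HasSmallReflex` (`E♯ = τ(L)`, e.g. `L/ℚ` Galois) the `E♯`-idèle reciprocity transports to `L`-idèles
(§7, reflex transport in degree one).

References: [Deligne1971TravauxShimura] 5.7, 5.11, (5.11.1) (pp. 158–159); [Deligne1979ShimuraVarieties] 2.2.5, 2.3.1;
[MumfordAV1970] §7 Thm. p. 66; [SGA1] V §1; [GortzWedhorn2020] 14.57; [Milne2005ShimuraVarieties] Def. 12.8 (62), Rem. 12.9;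
[Liu2021] App. C Rem. C.15.
-/

set_option autoImplicit false

noncomputable section

open Function MulAction Topology NumberField IsDedekindDomain CategoryTheory CategoryTheory.Limits Matrix
  AlgebraicGeometry
open scoped Matrix ComplexOrder
open Literature.AlgebraicGeometry Literature.AlgebraicGeometry.Motives
open Literature.NumberTheory.Automorphic Literature.NumberTheory.Automorphic.UnitaryGroup
open Literature.NumberTheory.Automorphic.Liu2021.AppendixC (C5.OpenCompactSubgroup C5.SmallLevel)
open Literature.Geometry.ComplexHyperbolic Literature.Geometry.ComplexHyperbolic.BallModel
open Literature.NumberTheory.Automorphic.ShimuraDissection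
open Literature.AlgebraicGeometry.ShimuraVarieties Literature.AlgebraicGeometry.ShimuraVarieties.UnitaryCanonicalModel
open Literature.NumberTheory.ComplexMultiplication (reflexNormFiniteIdele)
open Literature.NumberTheory.AdelicBaseChange (finiteIdeleRelNorm)

namespace Literature.AlgebraicGeometry.ShimuraVarieties

namespace UnitaryCanonicalModel

namespace HeckeQuotient

/-! ### §1. Glue lemmas -/

/-- Naturality of `X_E(ℂ) → X(ℂ)` (`formPointsEquiv`, inverse direction) in the `E`-scheme `X`
(the tree's private `UnitaryShimuraRecordDescent.baseChangeEquiv_symm_map'`, re-proved). [folklore] -/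
private theorem formPointsEquiv_symm_map {E : Type} [Field E] [Algebra E ℂ] {X Y : SchemeOver E} (f : X ⟶ Y)
    (u : ComplexPoints ((Motives.baseChangeHom (algebraMap E ℂ)).obj X)) :
    (formPointsEquiv Y).symm (AlgPoints.map ((Motives.baseChangeHom (algebraMap E ℂ)).map f) u) =
      AlgPoints.map f ((formPointsEquiv X).symm u) := by
  apply Over.OverMorphism.ext
  dsimp only [formPointsEquiv]
  rw [AlgPoints.baseChangeEquiv_symm_apply_left, AlgPoints.map_apply, Over.comp_left,
    AlgPoints.map_apply, Over.comp_left, AlgPoints.baseChangeEquiv_symm_apply_left]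
  simp only [Category.assoc, Motives.baseChangeHom_map_left_comp_fst]
  exact (Category.assoc _ _ _).symm

/-- Bookkeeping: an endomorphism `a` intertwined with `b` through a natural isomorphism `e` is intertwined through
`e⁻¹` the other way. [folklore] -/
private theorem inv_app_comp_eq {J C : Type*} [Category J] [Category C] {F G : J ⥤ C} (e : F ≅ G) (j : J)
    {a : F.obj j ⟶ F.obj j} {b : G.obj j ⟶ G.obj j} (h : a ≫ e.hom.app j = e.hom.app j ≫ b) :
    e.inv.app j ≫ a = b ≫ e.inv.app j := by
  rw [← cancel_mono (e.hom.app j), Category.assoc, h, e.inv_hom_id_app_assoc, Category.assoc, e.inv_hom_id_app,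
    Category.comp_id]

/-- Bookkeeping: a natural family `κ_j : S_j ⟶ G_j` composed with `e⁻¹ : G ≅ F` is natural. [folklore] -/
private theorem comp_inv_app_natural {J C : Type*} [Category J] [Category C] {S F G : J ⥤ C} (e : F ≅ G)
    (κ : ∀ j, S.obj j ⟶ G.obj j) (hκ : ∀ {j j' : J} (f : j ⟶ j'), κ j ≫ G.map f = S.map f ≫ κ j')
    {j j' : J} (f : j ⟶ j') : (κ j ≫ e.inv.app j) ≫ F.map f = S.map f ≫ κ j' ≫ e.inv.app j' := by
  rw [Category.assoc, ← e.inv.naturality f, reassoc_of% (hκ f)]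

/-- Bookkeeping: with `e`, `a`, `b` as in `inv_app_comp_eq`, a pair `κ₁ ≫ b = κ₂` gives
`(κ₁ ≫ e⁻¹) ≫ a = κ₂ ≫ e⁻¹`. [folklore] -/
private theorem comp_inv_app_comp_eq {J C : Type*} [Category J] [Category C] {F G : J ⥤ C} (e : F ≅ G) (j : J) {X : C}
    {κ₁ κ₂ : X ⟶ G.obj j} {a : F.obj j ⟶ F.obj j} {b : G.obj j ⟶ G.obj j}
    (h : a ≫ e.hom.app j = e.hom.app j ≫ b) (hκ : κ₁ ≫ b = κ₂) :
    (κ₁ ≫ e.inv.app j) ≫ a = κ₂ ≫ e.inv.app j := by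
  rw [Category.assoc, inv_app_comp_eq e j h, ← Category.assoc, hκ]

/-! ### §2. The generic target, PROVED: a separated finite-group quotient descends «reciprocity up to `Δ`» -/

/-- **Quotient reciprocity descent (generic form of [Deligne1971TravauxShimura] (5.11.1))**: base field `E` with
an `E`-algebra structure on `ℂ` (`algebraMap E ℂ`; `= ιE` under `letI := ιE.toAlgebra`); a tower `Mc : J ⥤ (ℂ-schemes)` of separated complex varieties; a tower `N : J ⥤ (E-schemes)` of
PROJECTIVE `E`-schemes with a finite group `Δ` acting by `E`-automorphisms naturally in `j`; cofans
`ι_j : Δ → (Mc_j ⟶ N_j ⊗_E ℂ)` exhibiting `N_j ⊗ ℂ` as `∐_Δ Mc_j`, natural in `j`, the action permuting the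
copies by left translation; and ANY family of test relations `R_j σ u u'` («`σ` ought to send the point over `u` to
the point over `u'`», `σ ∈ Aut(ℂ/E)`, `u, u' ∈ Mc_j(ℂ)`).  IF `N` satisfies every test UP TO `Δ` — `σ` sends the
point of `N_j` over `(u, δ)` to the point over `(u', δ')` for SOME `δ'` (points of `N_j ⊗ ℂ` read as `E`-algebra
points of `N_j` through `formPointsEquiv`, on which `Aut(ℂ/E)` acts) — THEN `Mc` has an `E`-form
`(M, e : M ⊗ ℂ ≅ Mc)` satisfying every test on the nose.  (`M_j := N_j/Δ`.)  This is the mathematical content of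
the line; the statements in the `HypDel` vocabulary below are instances.  PROVED: functorial finite quotient over `E`
(tree `Motives.exists_finiteQuotient_functor`) + base change of separated quotients to `ℂ`
(`Motives.isSepQuotient_baseChangeHom_of_isProjectiveOver`) + torsor quotient (`Motives.isIso_cofanInj_comp_of_isSepQuotient`):
the form is `M := N/Δ`, `e_j⁻¹ := ι_j 1 ≫ (q_j ⊗ ℂ)`, natural in `j`; a test `R_j σ u u'` holds for `(M, e)` because it is the image
under `q_j` of the assumed test-up-to-`Δ` for `N_j`, the copy index being forgotten as `ρ_j(δ) ≫ q_j = q_j`. [cite: Deligne1971TravauxShimura,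
Prop. 5.11, (5.11.1), Cor. 5.7] [cite: MumfordAV1970, §7] -/
theorem quotientReciprocityDescent :
    ∀ (E : Type) [Field E] [Algebra E ℂ] (J : Type) [SmallCategory J] (Mc : J ⥤ SchemeOver ℂ),
      (∀ j : J, IsSeparated (Mc.obj j).hom) →
      ∀ (Δ : Type) [Group Δ] [Fintype Δ] (N : J ⥤ SchemeOver E), (∀ j : J, IsProjectiveOver (N.obj j)) →
      ∀ ρ : ∀ j : J, Δ →* Aut (N.obj j),
        (∀ (j j' : J) (f : j ⟶ j') (g : Δ), (ρ j g).hom ≫ N.map f = N.map f ≫ (ρ j' g).hom) →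
      ∀ ι : ∀ j : J, Δ → (Mc.obj j ⟶ (Motives.baseChangeHom (algebraMap E ℂ)).obj (N.obj j)),
        (∀ j : J, Nonempty (IsColimit (Cofan.mk ((Motives.baseChangeHom (algebraMap E ℂ)).obj (N.obj j)) (ι j)))) →
        (∀ (j j' : J) (f : j ⟶ j') (δ : Δ), ι j δ ≫ (Motives.baseChangeHom (algebraMap E ℂ)).map (N.map f) = Mc.map f ≫ ι j' δ) →
        (∀ (j : J) (g δ : Δ), ι j δ ≫ (Motives.baseChangeHom (algebraMap E ℂ)).map (ρ j g).hom = ι j (g * δ)) →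
        ∀ R : ∀ j : J, (ℂ ≃ₐ[E] ℂ) → ComplexPoints (Mc.obj j) → ComplexPoints (Mc.obj j) → Prop,
          (∀ (j : J) (σ : ℂ ≃ₐ[E] ℂ) (u u' : ComplexPoints (Mc.obj j)), R j σ u u' → ∀ δ : Δ, ∃ δ' : Δ,
              σ • (formPointsEquiv (N.obj j)).symm (AlgPoints.map (ι j δ) u) =
                (formPointsEquiv (N.obj j)).symm (AlgPoints.map (ι j δ') u')) →
          ∃ (M : J ⥤ SchemeOver E) (e : (M ⋙ Motives.baseChangeHom (algebraMap E ℂ)) ≅ Mc),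
            ∀ (j : J) (σ : ℂ ≃ₐ[E] ℂ) (u u' : ComplexPoints (Mc.obj j)), R j σ u u' →
              σ • (formPointsEquiv (M.obj j)).symm (AlgPoints.map (e.inv.app j) u) =
                (formPointsEquiv (M.obj j)).symm (AlgPoints.map (e.inv.app j) u') := by
  intro E _ _ J _ Mc hMc Δ _ _ N hN ρ hρ ι hι hιnat hιρ R hrec
  obtain ⟨M, q, hsep, hquot⟩ := Literature.AlgebraicGeometry.Motives.exists_finiteQuotient_functor E J Δ N hN ρ hρ
  -- the quotient base-changed to `ℂ`
  have hC : ∀ j : J,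
      IsSeparated ((Motives.baseChangeHom (algebraMap E ℂ)).obj (M.obj j)).hom ∧
        IsSepQuotient (fun g => (Motives.baseChangeHom (algebraMap E ℂ)).mapIso (ρ j g)) ((Motives.baseChangeHom (algebraMap E ℂ)).map (q.app j)) :=
    fun j => Literature.AlgebraicGeometry.Motives.isSepQuotient_baseChangeHom_of_isProjectiveOver E (algebraMap E ℂ) Δ
      (N.obj j) (M.obj j) (hquot j).1 (ρ j) (q.app j) (hsep j) (hquot j).2
  -- invariance of `q_j` under `Δ`
  have hinv : ∀ (j : J) (g : Δ), (ρ j g).hom ≫ q.app j = q.app j := fun j g => (hquot j).2.1 g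
  -- every copy maps isomorphically onto `M_j ⊗ ℂ`
  have hiso : ∀ (j : J) (δ : Δ), IsIso (ι j δ ≫ (Motives.baseChangeHom (algebraMap E ℂ)).map (q.app j)) := by
    intro j δ
    refine Literature.AlgebraicGeometry.Motives.isIso_cofanInj_comp_of_isSepQuotient Δ (Mc.obj j) ((Motives.baseChangeHom (algebraMap E ℂ)).obj (N.obj j)) ((Motives.baseChangeHom (algebraMap E ℂ)).obj (M.obj j))
      (fun g => (Motives.baseChangeHom (algebraMap E ℂ)).mapIso (ρ j g)) (ι j) (hι j) (fun g δ' => ?_)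
      ((Motives.baseChangeHom (algebraMap E ℂ)).map (q.app j)) (hC j).1 (hMc j) (hC j).2 δ
    simpa only [Functor.mapIso_hom] using hιρ j g δ'
  -- the form `e : M ⊗ ℂ ≅ Mc`, `e_j⁻¹ = ι_j 1 ≫ (q_j ⊗ ℂ)`
  let eK : ∀ j : J, Mc.obj j ≅ (M ⋙ Motives.baseChangeHom (algebraMap E ℂ)).obj j := fun j =>
    @asIso _ _ _ _ (ι j 1 ≫ (Motives.baseChangeHom (algebraMap E ℂ)).map (q.app j)) (hiso j 1)
  let e' : Mc ≅ M ⋙ Motives.baseChangeHom (algebraMap E ℂ) := NatIso.ofComponents eK (fun {j j'} f => by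
    show Mc.map f ≫ (ι j' 1 ≫ (Motives.baseChangeHom (algebraMap E ℂ)).map (q.app j')) =
      (ι j 1 ≫ (Motives.baseChangeHom (algebraMap E ℂ)).map (q.app j)) ≫ (Motives.baseChangeHom (algebraMap E ℂ)).map (M.map f)
    rw [Category.assoc, ← Functor.map_comp, ← q.naturality f, Functor.map_comp, ← Category.assoc (ι j 1),
      hιnat j j' f 1, Category.assoc])
  refine ⟨M, e'.symm, ?_⟩
  -- reading a point of `M_j` through `e` = image under `q_j` of the point of `N_j` in ANY copy
  have key : ∀ (j : J) (u : ComplexPoints (Mc.obj j)) (δ : Δ),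
      (formPointsEquiv (M.obj j)).symm (AlgPoints.map (e'.symm.inv.app j) u) =
        AlgPoints.map (q.app j) ((formPointsEquiv (N.obj j)).symm (AlgPoints.map (ι j δ) u)) := by
    intro j u δ
    have h1 : e'.symm.inv.app j = ι j 1 ≫ (Motives.baseChangeHom (algebraMap E ℂ)).map (q.app j) := rfl
    have h2 : ι j δ = ι j 1 ≫ (Motives.baseChangeHom (algebraMap E ℂ)).map (ρ j δ).hom := by
      rw [hιρ j δ 1, mul_one]
    calc (formPointsEquiv (M.obj j)).symm (AlgPoints.map (e'.symm.inv.app j) u)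
        = (formPointsEquiv (M.obj j)).symm
            (AlgPoints.map ((Motives.baseChangeHom (algebraMap E ℂ)).map (q.app j)) (AlgPoints.map (ι j 1) u)) := by
          rw [h1, AlgPoints.map_comp_apply]
      _ = AlgPoints.map (q.app j) ((formPointsEquiv (N.obj j)).symm (AlgPoints.map (ι j 1) u)) :=
          formPointsEquiv_symm_map (q.app j) _
      _ = AlgPoints.map (q.app j) (AlgPoints.map (ρ j δ).hom
            ((formPointsEquiv (N.obj j)).symm (AlgPoints.map (ι j 1) u))) := by
          rw [← AlgPoints.map_comp_apply (ρ j δ).hom (q.app j), hinv j δ]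
      _ = AlgPoints.map (q.app j) ((formPointsEquiv (N.obj j)).symm
            (AlgPoints.map ((Motives.baseChangeHom (algebraMap E ℂ)).map (ρ j δ).hom) (AlgPoints.map (ι j 1) u))) := by
          rw [formPointsEquiv_symm_map]
      _ = AlgPoints.map (q.app j) ((formPointsEquiv (N.obj j)).symm (AlgPoints.map (ι j δ) u)) := by
          rw [← AlgPoints.map_comp_apply (ι j 1), ← h2]
  -- every test holds for `(M, e)`
  intro j σ u u' hR
  obtain ⟨δ', h⟩ := hrec j σ u u' hR 1
  rw [key j u 1, key j u' δ', ← AlgPoints.map_smul, h]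

/-! ### §3. Finite Hecke quotient descent in the vocabulary of `HypDel`, PROVED -/

set_option maxHeartbeats 800000 in -- large adelic / Shimura-set binders
/-- **Finite Hecke quotient descent over a base `E`** ([Deligne1971TravauxShimura] (5.11.1) READ for the product
datum `G̃ = G × T₀` over `E ⊇ E♯`; the shape A-plan1's `stub_reflexCompositumModel` consumes at `E := E♯_Φ`): a
tower `N` of PROJECTIVE `E`-schemes on the small levels with a natural action of a finite group `Δ` (Hecke
translations by `T₀(𝔸_f)`, `Δ = T₀(ℚ)\T₀(𝔸_f)/L₀`), complex fibres `= ∐_Δ Sc.Mc_K` (cofans natural in `K`,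
action = left translation of copies) and reciprocity UP TO `Δ` (`IsCanonicalDescentUpTo`) ⟹ an `E`-form of `Sc.Mc`
with reciprocity (62) (`IsCanonicalDescentOver`). PROVED from `quotientReciprocityDescent`: the tests are the diagonal
special pairs `(σ; [x, aK] ↦ [x, r_x(s)·aK])`; `Sc.Mc_K` is separated because projective.
[cite: Deligne1971TravauxShimura, Prop. 5.11, (5.11.1), Cor. 5.7] [cite: Deligne1979ShimuraVarieties, 2.2.5] -/
theorem heckeQuotientDescentOver :
    ∀ (L : Type) [Field L] [NumberField L] [IsCMField L] (H : Matrix (Fin 3) (Fin 3) L) (τ : L →+* ℂ)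
      (T : GL (Fin 3) ℂ) (hT : formCongr (starRingEnd ℂ) T (H.map τ) = BallModel.J)
      (K₀ : C5.OpenCompactSubgroup ↥(finAdelic (↥(maximalRealSubfield L)) L (IsCMField.complexConj L) 3 H))
      (Sc : ComplexRecordSystem L H τ T hT K₀) (E : Type) [Field E] (ιE : E →+* ℂ)
      (Δ : Type) [Group Δ] [Fintype Δ] (N : C5.SmallLevel K₀ ⥤ SchemeOver E),
      (∀ K, IsProjectiveOver (N.obj K)) →
      ∀ ρ : ∀ K : C5.SmallLevel K₀, Δ →* Aut (N.obj K),
        (∀ (K K' : C5.SmallLevel K₀) (f : K ⟶ K') (g : Δ), (ρ K g).hom ≫ N.map f = N.map f ≫ (ρ K' g).hom) →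
      ∀ ι : ∀ K : C5.SmallLevel K₀, Δ → (Sc.Mc.obj K ⟶ (Motives.baseChangeHom ιE).obj (N.obj K)),
        (∀ K, Nonempty (IsColimit (Cofan.mk ((Motives.baseChangeHom ιE).obj (N.obj K)) (ι K)))) →
        (∀ (K K' : C5.SmallLevel K₀) (f : K ⟶ K') (δ : Δ),
            ι K δ ≫ (Motives.baseChangeHom ιE).map (N.map f) = Sc.Mc.map f ≫ ι K' δ) →
        (∀ (K : C5.SmallLevel K₀) (g δ : Δ), ι K δ ≫ (Motives.baseChangeHom ιE).map (ρ K g).hom = ι K (g * δ)) →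
        IsCanonicalDescentUpTo Sc ιE Δ N ι →
        ∃ (M : C5.SmallLevel K₀ ⥤ SchemeOver E) (e : (M ⋙ Motives.baseChangeHom ιE) ≅ Sc.Mc),
          IsCanonicalDescentOver Sc ιE M e := by
  intro L _ _ _ H τ T hT K₀ Sc E _ ιE Δ _ _ N hN ρ hρ ι hι hιnat hιρ hrec
  letI : Algebra E ℂ := ιE.toAlgebra
  have hMc : ∀ K : C5.SmallLevel K₀, IsSeparated (Sc.Mc.obj K).hom := fun K => by
    haveI : IsProper (Sc.Mc.obj K).hom := Motives.IsProjectiveOver.isProper (Sc.projective K)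
    infer_instance
  -- the test relations: diagonal special pairs
  let R : ∀ K : C5.SmallLevel K₀, (ℂ ≃ₐ[E] ℂ) → ComplexPoints (Sc.Mc.obj K) → ComplexPoints (Sc.Mc.obj K) → Prop :=
    fun K σ u u' => ∃ (s : (FiniteAdeleRing (𝓞 L) L)ˣ) (v₃ : Fin 3 → L) (x : Ball)
      (d a : finAdelic (↥(maximalRealSubfield L)) L (IsCMField.complexConj L) 3 H),
      IsArtinCorrespondent L τ s σ.toRingEquiv ∧ IsLinePoint L τ T v₃ x ∧ IsDiagTwist L H v₃ (recipFactor L s) d ∧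
        u = (Sc.pts K).symm (ShimuraSet.mk L H τ T hT K.1.1 x a) ∧
        u' = (Sc.pts K).symm (ShimuraSet.mk L H τ T hT K.1.1 x (d * a))
  have hrecR : ∀ (K : C5.SmallLevel K₀) (σ : ℂ ≃ₐ[E] ℂ) (u u' : ComplexPoints (Sc.Mc.obj K)), R K σ u u' →
      ∀ δ : Δ, ∃ δ' : Δ,
        σ • (formPointsEquiv (N.obj K)).symm (AlgPoints.map (ι K δ) u) =
          (formPointsEquiv (N.obj K)).symm (AlgPoints.map (ι K δ') u') := by
    rintro K σ u u' ⟨s, v₃, x, d, a, hs, hx, hd, rfl, rfl⟩ δ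
    exact hrec K σ s hs v₃ x hx d hd a δ
  obtain ⟨M, e, hM⟩ := quotientReciprocityDescent E (C5.SmallLevel K₀) Sc.Mc hMc Δ N hN ρ hρ ι hι hιnat hιρ R hrecR
  refine ⟨M, e, ?_⟩
  intro K σ s hs v₃ x hx d hd a
  exact hM K σ _ _ ⟨s, v₃, x, d, a, hs, hx, hd, rfl, rfl⟩

/-- **Finite Hecke quotient descent at the reflex field** (`E = L`, `ιE = τ`): the same, concluding
`∃ M e, IsCanonicalDescentAt Sc M e` — the conclusion of `canonicalModel_exists_form` at `Sc` (and of
`canonicalModel_exists_printed` by `canonicalModel_exists_printed_iff_form`).  This is the junction for the GALOIS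
leg of `HypDel` (ruling D-I2: `StubGaloisCase`), where `E♯ = τ(L)`. PROVED from `heckeQuotientDescentOver` at `E = L`,
`ιE = τ` through `isCanonicalDescentOver_iff`. [cite: Deligne1971TravauxShimura, (5.11.1)] [cite: Liu2021, Rem. C.15] -/
theorem heckeQuotientDescent :
    ∀ (L : Type) [Field L] [NumberField L] [IsCMField L] (H : Matrix (Fin 3) (Fin 3) L) (τ : L →+* ℂ)
      (T : GL (Fin 3) ℂ) (hT : formCongr (starRingEnd ℂ) T (H.map τ) = BallModel.J)
      (K₀ : C5.OpenCompactSubgroup ↥(finAdelic (↥(maximalRealSubfield L)) L (IsCMField.complexConj L) 3 H))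
      (Sc : ComplexRecordSystem L H τ T hT K₀)
      (Δ : Type) [Group Δ] [Fintype Δ] (N : C5.SmallLevel K₀ ⥤ SchemeOver L),
      (∀ K, IsProjectiveOver (N.obj K)) →
      ∀ ρ : ∀ K : C5.SmallLevel K₀, Δ →* Aut (N.obj K),
        (∀ (K K' : C5.SmallLevel K₀) (f : K ⟶ K') (g : Δ), (ρ K g).hom ≫ N.map f = N.map f ≫ (ρ K' g).hom) →
      ∀ ι : ∀ K : C5.SmallLevel K₀, Δ → (Sc.Mc.obj K ⟶ (Motives.baseChangeHom τ).obj (N.obj K)),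
        (∀ K, Nonempty (IsColimit (Cofan.mk ((Motives.baseChangeHom τ).obj (N.obj K)) (ι K)))) →
        (∀ (K K' : C5.SmallLevel K₀) (f : K ⟶ K') (δ : Δ),
            ι K δ ≫ (Motives.baseChangeHom τ).map (N.map f) = Sc.Mc.map f ≫ ι K' δ) →
        (∀ (K : C5.SmallLevel K₀) (g δ : Δ), ι K δ ≫ (Motives.baseChangeHom τ).map (ρ K g).hom = ι K (g * δ)) →
        IsCanonicalDescentUpTo Sc τ Δ N ι →
        ∃ (M : C5.SmallLevel K₀ ⥤ SchemeOver L) (e : (M ⋙ Motives.baseChangeHom τ) ≅ Sc.Mc),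
          IsCanonicalDescentAt Sc M e := by
  intro L _ _ _ H τ T hT K₀ Sc Δ _ _ N hN ρ hρ ι hι hιnat hιρ hrec
  obtain ⟨M, e, hM⟩ := heckeQuotientDescentOver L H τ T hT K₀ Sc L τ Δ N hN ρ hρ ι hι hιnat hιρ hrec
  exact ⟨M, e, (isCanonicalDescentOver_iff Sc M e).mp hM⟩

/-! ### §4. On B-typ03's auxiliary carriers: F1's conclusion ⟹ a `Δ`-free `E♯`-form (junction J2), PROVED -/

set_option maxHeartbeats 1600000 in -- large adelic / Shimura-set binders
/-- **F1 ⟹ `Δ`-free `E♯`-form (junction J2)**, the statement.  Hypotheses: the class group `T₀(ℚ)\T₀(𝔸_f)/L₀`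
finite (ref2 glue g5, owner typ03/A-side), the reflex norm of every `E♯`-idèle in `T₀(𝔸_f)` (ref2 glue g4,
[Shimura1998] (19.7b)), and the CONCLUSION OF F1 AS LANDED (`Aux.canonicalModel_exists_printed`, p591128, J1 shape)
VERBATIM: an `E♯`-form `(N, e)` of B-typ03's `Aux.complexSystem Sc L₀ = ∐_{T₀(ℚ)\T₀(𝔸_f)/L₀} Sc.Mc` with the torus
Hecke translations descended to `E♯` (`ρ`, natural in `K`, intertwined with `Aux.translMor` through `e`) and the
reciprocity `Aux.IsCanonicalDescentAt Φ L₀ Sc N e`.  Conclusion: the finite Hecke quotient `N/Δ` is an `E♯`-form of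
`Sc.Mc` with reciprocity (62) in the same conventions (`IsCanonicalDescentOverReflex`).  Projectivity of `N_K` is NOT
assumed: it is derived (`∐ Sc.Mc_K` projective, tree `isProjectiveOver_of_isColimit_cofan`; descent along `E♯ → ℂ`,
tree `IsProjectiveOver.of_baseChange_holds` = [GortzWedhorn2020] Prop. 14.57, PROVED).  PROVED (from `quotientReciprocityDescent`).
[cite: Deligne1971TravauxShimura, (5.11.1)] [cite: Deligne1979ShimuraVarieties, 2.2.5, 2.3.1] -/
theorem auxQuotientDescent :
    ∀ (L : Type) [Field L] [NumberField L] [IsCMField L] (H : Matrix (Fin 3) (Fin 3) L) (τ : L →+* ℂ)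
      (T : GL (Fin 3) ℂ) (hT : formCongr (starRingEnd ℂ) T (H.map τ) = BallModel.J)
      (K₀ : C5.OpenCompactSubgroup ↥(finAdelic (↥(maximalRealSubfield L)) L (IsCMField.complexConj L) 3 H))
      (Sc : ComplexRecordSystem L H τ T hT K₀) (Φ : CMType L)
      (L₀ : C5.OpenCompactSubgroup ↥(Aux.torusFinAdelic L)) [Finite (Aux.classGroup L L₀)],
      (haveI : NumberField ↥(Aux.reflexField L Φ τ) := Aux.numberField_reflexField L Φ τ
       ∀ s : (FiniteAdeleRing (𝓞 ↥(Aux.reflexField L Φ τ)) ↥(Aux.reflexField L Φ τ))ˣ,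
         reflexNormFiniteIdele L Φ (Aux.reflexField L Φ τ) s ∈ Aux.torusFinAdelic L) →
      (∃ (N : C5.SmallLevel K₀ ⥤ SchemeOver ↥(Aux.reflexField L Φ τ))
          (ρ : ∀ K : C5.SmallLevel K₀, Aux.classGroup L L₀ →* Aut (N.obj K))
          (e : (N ⋙ Motives.baseChange ↥(Aux.reflexField L Φ τ) ℂ) ≅ Aux.complexSystem Sc L₀),
          (∀ (K K' : C5.SmallLevel K₀) (f : K ⟶ K') (c : Aux.classGroup L L₀),
              (ρ K c).hom ≫ N.map f = N.map f ≫ (ρ K' c).hom) ∧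
          (∀ (K : C5.SmallLevel K₀) (c : Aux.classGroup L L₀),
              (Motives.baseChange ↥(Aux.reflexField L Φ τ) ℂ).map (ρ K c).hom ≫ e.hom.app K =
                e.hom.app K ≫ Aux.translMor Sc L₀ K c) ∧
          Aux.IsCanonicalDescentAt Φ L₀ Sc N e) →
      ∃ (M : C5.SmallLevel K₀ ⥤ SchemeOver ↥(Aux.reflexField L Φ τ))
        (e' : (M ⋙ Motives.baseChange ↥(Aux.reflexField L Φ τ) ℂ) ≅ Sc.Mc), IsCanonicalDescentOverReflex Φ Sc M e' := by
  rintro L _ _ _ H τ T hT K₀ Sc Φ L₀ _ hg4 ⟨N, ρ, e, hρ, hρe, hF1⟩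
  haveI : NumberField ↥(Aux.reflexField L Φ τ) := Aux.numberField_reflexField L Φ τ
  letI : Algebra L ↥(Aux.reflexField L Φ τ) := (Aux.toReflexField L Φ τ).toAlgebra
  letI : Fintype (Aux.classGroup L L₀) := Fintype.ofFinite _
  -- projectivity of the `E♯`-models `N_K` (ref2 glue g7): `∐ Sc.Mc_K` is projective, transported along `e_K`, descended
  have hN : ∀ K : C5.SmallLevel K₀, IsProjectiveOver (N.obj K) := fun K => by
    have hcop : IsProjectiveOver ((Aux.complexSystem Sc L₀).obj K) :=
      Motives.isProjectiveOver_of_isColimit_cofan (coproductIsCoproduct fun _ : Aux.classGroup L L₀ => Sc.Mc.obj K)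
        fun _ => Sc.projective K
    have hbc : IsProjectiveOver ((N ⋙ Motives.baseChange ↥(Aux.reflexField L Φ τ) ℂ).obj K) := by
      obtain ⟨n, κ', hκ'⟩ := hcop
      haveI := hκ'
      haveI : IsIso (e.app K).hom.left := (inferInstance : IsIso ((Over.forget _).mapIso (e.app K)).hom)
      exact ⟨n, (e.app K).hom ≫ κ', inferInstanceAs (IsClosedImmersion ((e.app K).hom.left ≫ κ'.left))⟩
    exact Motives.IsProjectiveOver.of_baseChange_holds (N.obj K) ℂ hbc
  have hMc : ∀ K : C5.SmallLevel K₀, IsSeparated (Sc.Mc.obj K).hom := fun K => by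
    haveI : IsProper (Sc.Mc.obj K).hom := Motives.IsProjectiveOver.isProper (Sc.projective K)
    infer_instance
  -- the coprojections, as morphisms into `(Aux.complexSystem Sc L₀).obj K`
  let κ : ∀ K : C5.SmallLevel K₀, Aux.classGroup L L₀ → (Sc.Mc.obj K ⟶ (Aux.complexSystem Sc L₀).obj K) :=
    fun K p => Limits.Sigma.ι (fun _ : Aux.classGroup L L₀ => Sc.Mc.obj K) p
  have hκnat : ∀ (p : Aux.classGroup L L₀) {K K' : C5.SmallLevel K₀} (f : K ⟶ K'),
      κ K p ≫ (Aux.complexSystem Sc L₀).map f = Sc.Mc.map f ≫ κ K' p :=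
    fun p K K' f => Limits.Sigma.ι_map (fun _ : Aux.classGroup L L₀ => Sc.Mc.map f) p
  have hκρ : ∀ (K : C5.SmallLevel K₀) (c p : Aux.classGroup L L₀), κ K p ≫ Aux.translMor Sc L₀ K c = κ K (c * p) :=
    fun K c p => Limits.Sigma.ι_desc _ _
  -- the cofans `ι_K p := κ_K p ≫ e⁻¹_K`
  let ι : ∀ K : C5.SmallLevel K₀, Aux.classGroup L L₀ →
      (Sc.Mc.obj K ⟶ (N ⋙ Motives.baseChange ↥(Aux.reflexField L Φ τ) ℂ).obj K) :=
    fun K p => κ K p ≫ e.inv.app K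
  have hιdef : ∀ (K : C5.SmallLevel K₀) (p : Aux.classGroup L L₀), ι K p = κ K p ≫ e.inv.app K := fun K p => rfl
  have hκdef : ∀ (K : C5.SmallLevel K₀) (p : Aux.classGroup L L₀),
      κ K p = Limits.Sigma.ι (fun _ : Aux.classGroup L L₀ => Sc.Mc.obj K) p := fun K p => rfl
  have hι : ∀ K : C5.SmallLevel K₀,
      Nonempty (IsColimit (Cofan.mk ((N ⋙ Motives.baseChange ↥(Aux.reflexField L Φ τ) ℂ).obj K) (ι K))) :=
    fun K => ⟨IsColimit.ofIsoColimit (coproductIsCoproduct fun _ : Aux.classGroup L L₀ => Sc.Mc.obj K)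
      (Cofan.ext (e.app K).symm (fun p => rfl))⟩
  have hιnat : ∀ (K K' : C5.SmallLevel K₀) (f : K ⟶ K') (p : Aux.classGroup L L₀),
      ι K p ≫ (N ⋙ Motives.baseChange ↥(Aux.reflexField L Φ τ) ℂ).map f = Sc.Mc.map f ≫ ι K' p :=
    fun K K' f p => comp_inv_app_natural (S := Sc.Mc) e (fun K => κ K p) (fun f => hκnat p f) f
  have hιρ : ∀ (K : C5.SmallLevel K₀) (c p : Aux.classGroup L L₀),
      ι K p ≫ (Motives.baseChange ↥(Aux.reflexField L Φ τ) ℂ).map (ρ K c).hom = ι K (c * p) :=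
    fun K c p => comp_inv_app_comp_eq e K (hρe K c) (hκρ K c p)
  -- the test relations: B-typ03's diagonal special pairs over `E♯`
  let R : ∀ K : C5.SmallLevel K₀, (ℂ ≃ₐ[↥(Aux.reflexField L Φ τ)] ℂ) →
      ComplexPoints (Sc.Mc.obj K) → ComplexPoints (Sc.Mc.obj K) → Prop :=
    fun K σ u u' => ∃ (s : (FiniteAdeleRing (𝓞 ↥(Aux.reflexField L Φ τ)) ↥(Aux.reflexField L Φ τ))ˣ)
      (v₃ : Fin 3 → L) (x : Ball) (d a : finAdelic (↥(maximalRealSubfield L)) L (IsCMField.complexConj L) 3 H),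
      UnitaryCanonicalModel.IsArtinCorrespondent ↥(Aux.reflexField L Φ τ) (algebraMap ↥(Aux.reflexField L Φ τ) ℂ) s
          σ.toRingEquiv ∧
        IsLinePoint L τ T v₃ x ∧ IsDiagTwist L H v₃ (recipFactor L (finiteIdeleRelNorm L ↥(Aux.reflexField L Φ τ) s)) d ∧
        u = (Sc.pts K).symm (ShimuraSet.mk L H τ T hT K.1.1 x a) ∧
        u' = (Sc.pts K).symm (ShimuraSet.mk L H τ T hT K.1.1 x (d * a))
  have hrecR : ∀ (K : C5.SmallLevel K₀) (σ : ℂ ≃ₐ[↥(Aux.reflexField L Φ τ)] ℂ) (u u' : ComplexPoints (Sc.Mc.obj K)),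
      R K σ u u' → ∀ p : Aux.classGroup L L₀, ∃ p' : Aux.classGroup L L₀,
        σ • (formPointsEquiv (N.obj K)).symm (AlgPoints.map (ι K p) u) =
          (formPointsEquiv (N.obj K)).symm (AlgPoints.map (ι K p') u') := by
    rintro K σ u u' ⟨s, v₃, x, d, a, hs, hx, hd, rfl, rfl⟩ p
    refine ⟨Aux.classOf L L₀ ⟨_, hg4 s⟩ * p, ?_⟩
    have key := hF1 K σ s hs v₃ x hx d hd ⟨_, hg4 s⟩ rfl a p
    rw [hιdef, hιdef, hκdef, hκdef]
    erw [AlgPoints.map_comp_apply, AlgPoints.map_comp_apply]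
    exact key
  obtain ⟨M, e', hM⟩ := quotientReciprocityDescent ↥(Aux.reflexField L Φ τ) (C5.SmallLevel K₀) Sc.Mc hMc
    (Aux.classGroup L L₀) N hN ρ hρ
    ι hι hιnat hιρ R hrecR
  refine ⟨M, e', ?_⟩
  intro K σ s hs v₃ x hx d hd a
  exact hM K σ _ _ ⟨s, v₃, x, d, a, hs, hx, hd, rfl, rfl⟩

/-! ### §5. The Galois leg under `HasSmallReflex` (reflex transport in degree one, tree theorem R), PROVED -/

/-- **T applied**: under `HasSmallReflex`, `E♯`-idèle reciprocity (`IsCanonicalDescentOverReflex`) gives `L`-idèle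
reciprocity over `E♯` (`IsCanonicalDescentAtReflex`) for the SAME form (by the tree's
`Aux.exists_finiteIdele_norm_eq_isArtinCorrespondent_of_hasSmallReflex`). [cite: Milne2005ShimuraVarieties, Rem. 12.9 p. 115] -/
theorem isCanonicalDescentAtReflex_of_overReflex {L : Type} [Field L] [NumberField L] [IsCMField L] {H : Matrix (Fin 3) (Fin 3) L}
    {τ : L →+* ℂ} {T : GL (Fin 3) ℂ} {hT : formCongr (starRingEnd ℂ) T (H.map τ) = BallModel.J}
    {K₀ : C5.OpenCompactSubgroup ↥(finAdelic (↥(maximalRealSubfield L)) L (IsCMField.complexConj L) 3 H)}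
    (Φ : CMType L) (Sc : ComplexRecordSystem L H τ T hT K₀) (hsm : Aux.HasSmallReflex L Φ τ)
    {M : C5.SmallLevel K₀ ⥤ SchemeOver ↥(Aux.reflexField L Φ τ)}
    {e : (M ⋙ Motives.baseChange ↥(Aux.reflexField L Φ τ) ℂ) ≅ Sc.Mc}
    (h : IsCanonicalDescentOverReflex Φ Sc M e) : IsCanonicalDescentAtReflex Φ Sc M e := by
  intro K σ s hs v₃ x hx d hd a
  haveI : NumberField ↥(Aux.reflexField L Φ τ) := Aux.numberField_reflexField L Φ τ
  letI : Algebra L ↥(Aux.reflexField L Φ τ) := (Aux.toReflexField L Φ τ).toAlgebra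
  obtain ⟨s', hN, hs'⟩ := Aux.exists_finiteIdele_norm_eq_isArtinCorrespondent_of_hasSmallReflex L Φ τ hsm σ.toRingEquiv s hs
  have hd' : IsDiagTwist L H v₃ (recipFactor L (finiteIdeleRelNorm L ↥(Aux.reflexField L Φ τ) s')) d := by
    rw [hN]; exact hd
  exact h K σ s' hs' v₃ x hx d hd' a

/-- **B-side junction for the Galois leg** (ruling D-I2, `StubGaloisCase`), the statement: at every hDel datum with
SMALL reflex field (`E*(Φ) ⊆ τL` — e.g. `L/ℚ` Galois, tree `reflexField_le_normalClosure`), class group finite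
(g5), reflex norms in `T₀(𝔸_f)` (g4), F1's conclusion (VERBATIM) ⟹ an `E♯`-form of `Sc.Mc` with Shimura
reciprocity (62) for `Aut(ℂ/E♯)` and `L`-idèles.  PROVED (`auxQuotientDescent` + `isCanonicalDescentAtReflex_of_overReflex`). [cite: Deligne1971TravauxShimura, (5.11.1)]
[cite: Milne2005ShimuraVarieties, Def. 12.8 (62) p. 114] -/
theorem galoisLegDescent :
    ∀ (L : Type) [Field L] [NumberField L] [IsCMField L] (H : Matrix (Fin 3) (Fin 3) L) (τ : L →+* ℂ)
      (T : GL (Fin 3) ℂ) (hT : formCongr (starRingEnd ℂ) T (H.map τ) = BallModel.J)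
      (K₀ : C5.OpenCompactSubgroup ↥(finAdelic (↥(maximalRealSubfield L)) L (IsCMField.complexConj L) 3 H))
      (Sc : ComplexRecordSystem L H τ T hT K₀) (Φ : CMType L)
      (L₀ : C5.OpenCompactSubgroup ↥(Aux.torusFinAdelic L)) [Finite (Aux.classGroup L L₀)],
      Aux.HasSmallReflex L Φ τ →
      (haveI : NumberField ↥(Aux.reflexField L Φ τ) := Aux.numberField_reflexField L Φ τ
       ∀ s : (FiniteAdeleRing (𝓞 ↥(Aux.reflexField L Φ τ)) ↥(Aux.reflexField L Φ τ))ˣ,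
         reflexNormFiniteIdele L Φ (Aux.reflexField L Φ τ) s ∈ Aux.torusFinAdelic L) →
      (∃ (N : C5.SmallLevel K₀ ⥤ SchemeOver ↥(Aux.reflexField L Φ τ))
          (ρ : ∀ K : C5.SmallLevel K₀, Aux.classGroup L L₀ →* Aut (N.obj K))
          (e : (N ⋙ Motives.baseChange ↥(Aux.reflexField L Φ τ) ℂ) ≅ Aux.complexSystem Sc L₀),
          (∀ (K K' : C5.SmallLevel K₀) (f : K ⟶ K') (c : Aux.classGroup L L₀),
              (ρ K c).hom ≫ N.map f = N.map f ≫ (ρ K' c).hom) ∧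
          (∀ (K : C5.SmallLevel K₀) (c : Aux.classGroup L L₀),
              (Motives.baseChange ↥(Aux.reflexField L Φ τ) ℂ).map (ρ K c).hom ≫ e.hom.app K =
                e.hom.app K ≫ Aux.translMor Sc L₀ K c) ∧
          Aux.IsCanonicalDescentAt Φ L₀ Sc N e) →
      ∃ (M : C5.SmallLevel K₀ ⥤ SchemeOver ↥(Aux.reflexField L Φ τ))
        (e' : (M ⋙ Motives.baseChange ↥(Aux.reflexField L Φ τ) ℂ) ≅ Sc.Mc), IsCanonicalDescentAtReflex Φ Sc M e' := by
  intro L _ _ _ H τ T hfr K₀ Sc Φ L₀ _ hsm hg4 hF1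
  obtain ⟨M, e', hM⟩ := auxQuotientDescent L H τ T hfr K₀ Sc Φ L₀ hg4 hF1
  exact ⟨M, e', isCanonicalDescentAtReflex_of_overReflex Φ Sc hsm hM⟩

/-- **B-side junction for the Galois leg in A-plan1's requested shape** (INBOX 01:11:30Z): PROVED — at
every hDel datum with small reflex field, g5, g4 and F1's conclusion, an `E♯`-form `(M, e')` of `Sc.Mc` with
`IsCanonicalDescentOver Sc (algebraMap ↥E♯ ℂ) M e'` = stub (A) `stub_reflexCompositumModel`'s inner block at
`E := ↥E♯`, `ιE := algebraMap ↥E♯ ℂ` (a1-reflex-compositum.lean :100–113). [cite: Deligne1971TravauxShimura, (5.11.1)]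
[cite: Milne2005ShimuraVarieties, Def. 12.8 (62) p. 114] -/
theorem galoisLegDescentOver :
    ∀ (L : Type) [Field L] [NumberField L] [IsCMField L] (H : Matrix (Fin 3) (Fin 3) L) (τ : L →+* ℂ)
      (T : GL (Fin 3) ℂ) (hT : formCongr (starRingEnd ℂ) T (H.map τ) = BallModel.J)
      (K₀ : C5.OpenCompactSubgroup ↥(finAdelic (↥(maximalRealSubfield L)) L (IsCMField.complexConj L) 3 H))
      (Sc : ComplexRecordSystem L H τ T hT K₀) (Φ : CMType L)
      (L₀ : C5.OpenCompactSubgroup ↥(Aux.torusFinAdelic L)) [Finite (Aux.classGroup L L₀)],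
      Aux.HasSmallReflex L Φ τ →
      (haveI : NumberField ↥(Aux.reflexField L Φ τ) := Aux.numberField_reflexField L Φ τ
       ∀ s : (FiniteAdeleRing (𝓞 ↥(Aux.reflexField L Φ τ)) ↥(Aux.reflexField L Φ τ))ˣ,
         reflexNormFiniteIdele L Φ (Aux.reflexField L Φ τ) s ∈ Aux.torusFinAdelic L) →
      (∃ (N : C5.SmallLevel K₀ ⥤ SchemeOver ↥(Aux.reflexField L Φ τ))
          (ρ : ∀ K : C5.SmallLevel K₀, Aux.classGroup L L₀ →* Aut (N.obj K))
          (e : (N ⋙ Motives.baseChange ↥(Aux.reflexField L Φ τ) ℂ) ≅ Aux.complexSystem Sc L₀),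
          (∀ (K K' : C5.SmallLevel K₀) (f : K ⟶ K') (c : Aux.classGroup L L₀),
              (ρ K c).hom ≫ N.map f = N.map f ≫ (ρ K' c).hom) ∧
          (∀ (K : C5.SmallLevel K₀) (c : Aux.classGroup L L₀),
              (Motives.baseChange ↥(Aux.reflexField L Φ τ) ℂ).map (ρ K c).hom ≫ e.hom.app K =
                e.hom.app K ≫ Aux.translMor Sc L₀ K c) ∧
          Aux.IsCanonicalDescentAt Φ L₀ Sc N e) →
      ∃ (M : C5.SmallLevel K₀ ⥤ SchemeOver ↥(Aux.reflexField L Φ τ))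
        (e' : (M ⋙ Motives.baseChange ↥(Aux.reflexField L Φ τ) ℂ) ≅ Sc.Mc),
        IsCanonicalDescentOver Sc (algebraMap ↥(Aux.reflexField L Φ τ) ℂ) M e' := by
  intro L _ _ _ H τ T hfr K₀ Sc Φ L₀ _ hsm hg4 hF1
  obtain ⟨M, e', hM⟩ := galoisLegDescent L H τ T hfr K₀ Sc Φ L₀ hsm hg4 hF1
  exact ⟨M, e', (isCanonicalDescentAtReflex_iff_over Φ Sc M e').1 hM⟩

/-! ### §6. THE B-SIDE DELIVERABLE OF THE GALOIS LEG: F1 ⟹ the `E♯`-form with (62) for `L`-idèles -/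

/-- **THE B-SIDE DELIVERABLE OF THE GALOIS LEG (modulo the printed citation F1 as the hypothesis `hF1`; g4 discharged by the tree theorem `Aux.reflexNormFiniteIdele_mem_torusFinAdelic`)**:
F1 ⟹ at every hDel datum satisfying F1's printed side conditions, every adapted `Φ` with small reflex field (all
`Φ` when `L/ℚ` is Galois) and every `L₀` with finite class group, an `E♯`-form `(M, e')` of `Sc.Mc` with
`IsCanonicalDescentOver Sc (algebraMap ↥E♯ ℂ) M e'` — A-plan1's stub (A) inner block at `E := E♯` by name.
[cite: Deligne1971TravauxShimura, (5.11.1)] [cite: Milne2005ShimuraVarieties, Def. 12.8 (62) p. 114] -/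
theorem galoisLegDescentOver_of_F1 (hF1 : Aux.canonicalModel_exists_printed) :
    ∀ (L : Type) [Field L] [NumberField L] [IsCMField L] (H : Matrix (Fin 3) (Fin 3) L) (τ : L →+* ℂ)
      (T : GL (Fin 3) ℂ) (hT : formCongr (starRingEnd ℂ) T (H.map τ) = BallModel.J),
      (∀ τ' : L →+* ℂ, InfinitePlace.mk τ' ≠ InfinitePlace.mk τ → (H.map τ').PosDef) →
      (∀ v : Fin 3 → L, hermForm (cmConjRingHom L) H v v = 0 → v = 0) →
      ∀ K₀ : C5.OpenCompactSubgroup ↥(finAdelic (↥(maximalRealSubfield L)) L (IsCMField.complexConj L) 3 H),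
        (∀ g : finAdelic (↥(maximalRealSubfield L)) L (IsCMField.complexConj L) 3 H,
          ∀ γ ∈ arithmeticLevel (↥(maximalRealSubfield L)) L (IsCMField.complexConj L) 3 H
            (K₀.1.map (MulAut.conj g).toMonoidHom), IsOfFinOrder γ → γ = 1) →
        ∀ (Sc : ComplexRecordSystem L H τ T hT K₀) (Φ : CMType L), Aux.IsAdapted L Φ τ →
          Aux.HasSmallReflex L Φ τ →
          ∀ (L₀ : C5.OpenCompactSubgroup ↥(Aux.torusFinAdelic L)) [Finite (Aux.classGroup L L₀)],
            ∃ (M : C5.SmallLevel K₀ ⥤ SchemeOver ↥(Aux.reflexField L Φ τ))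
              (e' : (M ⋙ Motives.baseChange ↥(Aux.reflexField L Φ τ) ℂ) ≅ Sc.Mc),
              IsCanonicalDescentOver Sc (algebraMap ↥(Aux.reflexField L Φ τ) ℂ) M e' :=
  fun L _ _ _ H τ T hfr hpos han K₀ hneat Sc Φ hΦ hsm L₀ _ =>
    galoisLegDescentOver L H τ T hfr K₀ Sc Φ L₀ hsm (Aux.reflexNormFiniteIdele_mem_torusFinAdelic L Φ τ)
      (hF1 L H τ T hfr hpos han K₀ hneat Sc Φ hΦ L₀)

end HeckeQuotient

end UnitaryCanonicalModel

end Literature.AlgebraicGeometry.ShimuraVarieties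

end
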